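import Mathlib.Analysis.SpecialFunctions.Pow.Deriv
import Mathlib.NumberTheory.Real.Irrational
import Literature.Probability.LatticeModels.PlanarIsing
import Literature.Probability.RandomPlanarGeometry.CaratheodoryHalfPlane
import HarnessLib

/-!
# `chi_halfplane_onePoint` is false as stated: the slit disc

`Literature.Probability.LatticeModels.PlanarIsing` vendors, as the named fact
`Literature.Probability.LatticeModels.chi_halfplane_onePoint`, the explicit one-point function of the critical planar
Ising model (Chelkak–Hongler–Izyurov, Ann. of Math. 181 (2015) = arXiv:1202.2838 (CHI), Thm 1.3
with eqs. (1.2)–(1.3)), but **without CHI's standing hypothesis** that the discrete domains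
`Ω_δ` approximate `Ω` (`∂Ω_δ → ∂Ω` in the Hausdorff sense, CHI §2, p. 13), quantifying instead
over all admissible `Ω` with the fixed discretisation `meshDomain Ω δ` of
`DomainDiscretisation.lean`. This file **proves the negation** `not_chi_halfplane_onePoint`; the
corrected statement (with the hypothesis `MeshApproximates Ω`) is
`Literature.Probability.LatticeModels.chi_halfplane_onePoint_hausdorff` in `PlanarIsingOnePoint.lean`.
(Verdict clean-up 2026-08-15: the refuted def is now an `@[deprecated]` record kept only because
`not_chi_halfplane_onePoint` names it; `linter.deprecated` is silenced on that one theorem.)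

## The argument

* `meshIsingPlusCorr_eq_of_closure_eq`, `chiPlusCorr_eq_of_closure_eq` (coincidence lemma): the
  mesh graph `meshGraph Ω δ` only sees the closure `Ω̄` (edges are closed segments in `Ω̄`), so
  two domains with the same closure, the same boundedness and the same mesh vertices have
  literally the same discrete `+` correlations, hence the same CHI limit `chiPlusCorr`.
* `SlitDisc.domain = 𝔻 ∖ {t e^{iπ/3} | t ≥ 1/4}`: the unit disc slit along a ray of slope `√3`.
  No point of any lattice `δℤ²` lies on the slit (`√3` is irrational,
  `SlitDisc.meshPoint_not_mem_slit`) and the slit has empty interior, so the slit disc and the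
  disc have the same mesh vertices at every scale and the same closure
  (`SlitDisc.chiPlusCorr_domain`). Both are admissible (the slit disc is star-convex about `0`).
* Explicit uniformising maps onto `ℍ`: the inverse Cayley transform `w ↦ i(1 + w)/(1 - w)` for the
  disc (`Literature.Probability.RandomPlanarGeometry.cayley` of `CaratheodoryHalfPlane.lean`; value `i` and derivative `2i` at `0`), and
  for the slit disc `SlitDisc.unif = sqrtMap ∘ cayley⁻¹ ∘ (-conj dir · )`, where the rotation
  puts the slit onto `(-1, -1/4]`, the inverse Cayley transform sends it onto the vertical slit
  `(0, 3i/5]` of `ℍ`, and `sqrtMap w = i (-(w² + 9/25))^{1/2}` (principal branch) opens that slit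
  (`SlitDisc.isConformalBijection_unif`: holomorphy, `MapsTo`, injectivity and surjectivity are
  all proved by hand); at `0` it has `Im unif 0 = 4/5` and `|unif'(0)| = 5/2`.
* `not_chi_halfplane_onePoint`: at `a = 0` the fact would give `chiPlusCorr 𝔻 1 ![0] = 𝒞` and
  `chiPlusCorr (slit disc) 1 ![0] = 𝒞 · (5/2)^{1/8} (8/5)^{-1/8} = 𝒞 · (25/16)^{1/8}`, while the
  two left-hand sides are equal and `𝒞 > 0`: contradiction. (In conformal-radius terms:
  `rad(0, 𝔻) = 1 ≠ 16/25 = rad(0, slit disc)`, but the discretisation cannot tell them apart.)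

## References

* D. Chelkak, C. Hongler, K. Izyurov, *Conformal invariance of spin correlations in the planar
  Ising model*, Ann. of Math. (2) 181 (2015), 1087–1138; arXiv:1202.2838, §2 (p. 13):
  "we say that a family of discrete domains `(Ω_δ)` approximates `Ω` if `∂Ω_δ` converges to `∂Ω`
  in the Hausdorff sense".
* L. V. Ahlfors, *Complex Analysis*, 3rd ed. (1979), Ch. 3 §3 (Cayley transform), Ch. 6 §1.
-/

noncomputable section

open MeasureTheory Filter Topology Real
open Literature.Probability.LatticeModels

namespace Literature.Probability.LatticeModels

/-! ### The coincidence lemma behind the discrepancy -/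

/-- If two domains have the same closure and the same mesh vertices at scale `δ`, then their mesh
graphs coincide (`meshGraph` only sees `Ω̄`). [folklore] -/
theorem meshGraph_eq_of_closure_eq {Ω Ω' : Set ℂ} (h : closure Ω = closure Ω') (δ : ℝ) :
    meshGraph Ω δ = meshGraph Ω' δ := by
  ext x y
  rw [meshGraph_adj_iff, meshGraph_adj_iff, h]

/-- Same closure and same mesh vertices at scale `δ` ⇒ same discrete domain `Ω_δ`. [folklore] -/
theorem meshDomain_eq_of_closure_eq {Ω Ω' : Set ℂ} (h : closure Ω = closure Ω') {δ : ℝ}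
    (hV : meshVertices Ω δ = meshVertices Ω' δ) : meshDomain Ω δ = meshDomain Ω' δ := by
  unfold meshDomain meshVertexGraph
  rw [meshGraph_eq_of_closure_eq h δ]
  revert hV
  generalize meshVertices Ω δ = V
  rintro rfl
  rfl

/-- Same closure and same mesh vertices at scale `δ` ⇒ same graph `Ω_δ`. [folklore] -/
theorem discreteDomainGraph_eq_of_closure_eq {Ω Ω' : Set ℂ} (h : closure Ω = closure Ω')
    {δ : ℝ} (hV : meshVertices Ω δ = meshVertices Ω' δ) :
    discreteDomainGraph Ω δ = discreteDomainGraph Ω' δ := by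
  ext x y
  rw [discreteDomainGraph_adj_iff, discreteDomainGraph_adj_iff, meshGraph_eq_of_closure_eq h δ,
    meshDomain_eq_of_closure_eq h hV]

/-- Same closure and same mesh vertices at scale `δ` ⇒ same discrete boundary `∂Ω_δ`. [folklore] -/
theorem meshBoundary_eq_of_closure_eq {Ω Ω' : Set ℂ} (h : closure Ω = closure Ω') {δ : ℝ}
    (hV : meshVertices Ω δ = meshVertices Ω' δ) : meshBoundary Ω δ = meshBoundary Ω' δ := by
  ext x
  rw [mem_meshBoundary_iff, mem_meshBoundary_iff, meshDomain_eq_of_closure_eq h hV,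
    discreteDomainGraph_eq_of_closure_eq h hV]

/-- Same closure, same boundedness and same mesh vertices at scale `δ` ⇒ same `+`-volume
`Ω_δ ∖ ∂Ω_δ`. [folklore] -/
theorem meshInteriorFinset_eq_of_closure_eq {Ω Ω' : Set ℂ} (h : closure Ω = closure Ω')
    (hb : Bornology.IsBounded Ω ↔ Bornology.IsBounded Ω') {δ : ℝ}
    (hV : meshVertices Ω δ = meshVertices Ω' δ) :
    meshInteriorFinset Ω δ = meshInteriorFinset Ω' δ := by
  classical
  unfold meshInteriorFinset
  by_cases hΩ : Bornology.IsBounded Ω ∧ 0 < δ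
  · have hΩ' : Bornology.IsBounded Ω' ∧ 0 < δ := ⟨hb.1 hΩ.1, hΩ.2⟩
    rw [dif_pos hΩ, dif_pos hΩ']
    ext x
    simp only [Finset.mem_filter, Set.Finite.mem_toFinset]
    rw [meshDomain_eq_of_closure_eq h hV, meshBoundary_eq_of_closure_eq h hV]
  · have hΩ' : ¬ (Bornology.IsBounded Ω' ∧ 0 < δ) := fun h' => hΩ ⟨hb.2 h'.1, h'.2⟩
    rw [dif_neg hΩ, dif_neg hΩ']

/-- **The coincidence lemma.** If `Ω` and `Ω'` have the same closure, are both bounded or both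
unbounded, and have the same mesh vertices at scale `δ` (e.g. `Ω = Ω' ∖ S` for a slit `S ⊆ Ω'`
containing no mesh point), then their discrete `+` correlations at scale `δ` coincide: the tree's
discretisation does not see the slit. This is the mechanism making `chi_halfplane_onePoint`
(which lacks the hypothesis `MeshApproximates Ω`) false as stated. [folklore] -/
theorem meshIsingPlusCorr_eq_of_closure_eq {Ω Ω' : Set ℂ} (h : closure Ω = closure Ω')
    (hb : Bornology.IsBounded Ω ↔ Bornology.IsBounded Ω') {δ : ℝ}
    (hV : meshVertices Ω δ = meshVertices Ω' δ) {n : ℕ} (a : Fin n → ℂ) :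
    meshIsingPlusCorr Ω δ a = meshIsingPlusCorr Ω' δ a := by
  unfold meshIsingPlusCorr
  have hG := discreteDomainGraph_eq_of_closure_eq h hV
  have hΛ := meshInteriorFinset_eq_of_closure_eq h hb hV
  -- transport along the graph equality, the `LocallyFinite` instances being subsingletons
  have key : ∀ (G G' : SimpleGraph (Site 2)) (i : G.LocallyFinite) (i' : G'.LocallyFinite)
      (Λ Λ' : Finset (Site 2)), G = G' → Λ = Λ' →
      @isingExpect _ G _ i Λ criticalBetaTwo 0 .plus (spinMonomial fun j => nearestSite δ (a j)) =
        @isingExpect _ G' _ i' Λ' criticalBetaTwo 0 .plus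
          (spinMonomial fun j => nearestSite δ (a j)) := by
    rintro G _ i i' Λ _ rfl rfl
    rw [Subsingleton.elim i i']
  exact key _ _ _ _ _ _ hG hΛ

/-- Consequently the CHI limits coincide as well: `chiPlusCorr Ω = chiPlusCorr Ω'` whenever the
closures, the boundedness and *all* mesh vertex sets (every `δ > 0`) agree. [folklore] -/
theorem chiPlusCorr_eq_of_closure_eq {Ω Ω' : Set ℂ} (h : closure Ω = closure Ω')
    (hb : Bornology.IsBounded Ω ↔ Bornology.IsBounded Ω')
    (hV : ∀ δ : ℝ, 0 < δ → meshVertices Ω δ = meshVertices Ω' δ) (n : ℕ) (a : Fin n → ℂ) :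
    chiPlusCorr Ω n a = chiPlusCorr Ω' n a := by
  unfold chiPlusCorr limUnder
  congr 1
  refine Filter.map_congr ?_
  filter_upwards [self_mem_nhdsWithin] with δ hδ
  rw [meshIsingPlusCorr_eq_of_closure_eq h hb (hV δ hδ)]



/-! ### Refutation of `chi_halfplane_onePoint`: the slit disc

We exhibit an admissible domain that the tree's discretisation cannot see: the unit disc slit
along the ray `{t e^{iπ/3} | t ≥ 1/4}`. No point of any lattice `δℤ²` lies on this ray (its
slope `√3` is irrational), and every mesh edge crossing it stays in the closed disc, so by
`chiPlusCorr_eq_of_closure_eq` the CHI limits of the slit disc and of the disc coincide. But both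
domains have explicit uniformising maps onto `ℍ` (the inverse Cayley transform for the disc; for
the slit disc, the inverse Cayley transform followed by `w ↦ i (-(w² + 9/25))^{1/2}`, which opens
the vertical slit `(0, 3i/5]` of `ℍ`), whose values and derivatives at `0` give different
right-hand sides in `chi_halfplane_onePoint` (`𝒞` versus `𝒞 · (25/16)^{1/8}`). -/

namespace SlitDisc

/-- The direction `e^{iπ/3} = (1 + i√3)/2` of the slit. [folklore] -/
def dir : ℂ := ⟨1 / 2, Real.sqrt 3 / 2⟩

/-- The slit `{t e^{iπ/3} | t ≥ 1/4} = {z | Im z = √3 Re z, Re z ≥ 1/8}` (a closed condition).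
[folklore] -/
def slit : Set ℂ := {z | z.im = Real.sqrt 3 * z.re ∧ 1 / 8 ≤ z.re}

/-- The slit disc `𝔻 ∖ {t e^{iπ/3} | t ≥ 1/4}`. [folklore] -/
def domain : Set ℂ := Metric.ball (0 : ℂ) 1 \ slit

/-- The map `w ↦ i · (-(w² + 9/25))^{1/2}` (principal branch), a conformal bijection of
`ℍ ∖ (0, 3i/5]` onto `ℍ`. [folklore] -/
def sqrtMap (w : ℂ) : ℂ := Complex.I * (-(w ^ 2 + ((9 / 25 : ℝ) : ℂ))) ^ (2⁻¹ : ℂ)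

/-- The explicit uniformising map of the slit disc onto `ℍ`: rotate the slit onto `(-1, -1/4]`,
apply the inverse Cayley transform (slit `↦ (0, 3i/5]`), then `sqrtMap`. [folklore] -/
def unif (z : ℂ) : ℂ := sqrtMap (RandomPlanarGeometry.cayleyInvFun (-(starRingEnd ℂ dir) * z))

open Complex in
/-- `|dir|² = 1`. [folklore] -/
theorem normSq_dir : normSq dir = 1 := by
  rw [dir, normSq_mk]
  have h3 : Real.sqrt 3 * Real.sqrt 3 = 3 := Real.mul_self_sqrt (by norm_num)
  nlinarith [h3]

/-- `|dir| = 1`. [folklore] -/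
theorem norm_dir : ‖dir‖ = 1 := by
  have h : ‖dir‖ ^ 2 = 1 := by rw [← Complex.normSq_eq_norm_sq]; exact normSq_dir
  exact (pow_eq_one_iff_of_nonneg (norm_nonneg _) two_ne_zero).1 h

open Complex in
/-- `conj dir · dir = 1`. [folklore] -/
theorem conj_dir_mul_dir : starRingEnd ℂ dir * dir = 1 := by
  rw [← normSq_eq_conj_mul_self, normSq_dir]; simp

/-- Real multiples of the direction: `t · dir ∈ slit ↔ 1/4 ≤ t`. [folklore] -/
theorem ofReal_mul_dir_mem_slit_iff (t : ℝ) : (t : ℂ) * dir ∈ slit ↔ 1 / 4 ≤ t := by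
  simp only [slit, Set.mem_setOf_eq, dir, Complex.mul_re, Complex.mul_im, Complex.ofReal_re,
    Complex.ofReal_im, zero_mul, sub_zero, add_zero]
  constructor
  · rintro ⟨-, h⟩; linarith
  · intro h; exact ⟨by ring, by linarith⟩

/-- A point of the slit is `2 Re z · dir`. [folklore] -/
theorem eq_mul_dir_of_mem_slit {z : ℂ} (hz : z ∈ slit) : z = ((2 * z.re : ℝ) : ℂ) * dir := by
  obtain ⟨h1, -⟩ := hz
  apply Complex.ext <;> simp [dir, h1] <;> ring

/-- The centre is not on the slit. [folklore] -/
theorem zero_not_mem_slit : (0 : ℂ) ∉ slit := by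
  rintro ⟨-, h⟩; norm_num at h

/-- The slit is closed. [folklore] -/
theorem isClosed_slit : IsClosed slit :=
  (isClosed_eq Complex.continuous_im (continuous_const.mul Complex.continuous_re)).inter
    (isClosed_le continuous_const Complex.continuous_re)

/-- The slit disc is open. [folklore] -/
theorem isOpen_domain : IsOpen domain := Metric.isOpen_ball.sdiff isClosed_slit

/-- The centre belongs to the slit disc. [folklore] -/
theorem zero_mem_domain : (0 : ℂ) ∈ domain := ⟨Metric.mem_ball_self one_pos, zero_not_mem_slit⟩

/-- The slit disc is star-convex with respect to its centre. [folklore] -/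
theorem starConvex_domain : StarConvex ℝ (0 : ℂ) domain := by
  rintro y ⟨hy, hys⟩ a b ha hb hab
  refine ⟨?_, ?_⟩
  · rw [smul_zero, zero_add]
    exact (convex_ball (0 : ℂ) 1).starConvex (Metric.mem_ball_self one_pos)
      hy ha hb hab |> fun h => by simpa using h
  · rw [smul_zero, zero_add]
    rintro ⟨h1, h2⟩
    simp only [Complex.real_smul, Complex.mul_re, Complex.mul_im, Complex.ofReal_re,
      Complex.ofReal_im, zero_mul, sub_zero, add_zero] at h1 h2
    have hb0 : 0 < b := by
      rcases hb.lt_or_eq with hb0 | hb0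
      · exact hb0
      · rw [← hb0] at h2; norm_num at h2
    apply hys
    refine ⟨?_, ?_⟩
    · have : b * (y.im - Real.sqrt 3 * y.re) = 0 := by linarith
      rcases mul_eq_zero.1 this with h | h
      · exact absurd h hb0.ne'
      · linarith
    · have hb1 : b ≤ 1 := by linarith
      by_contra hcon
      push Not at hcon
      have : b * y.re < 1 / 8 := by
        rcases le_or_gt 0 y.re with hy0 | hy0
        · calc b * y.re ≤ 1 * y.re := mul_le_mul_of_nonneg_right hb1 hy0
            _ < 1 / 8 := by linarith
        · calc b * y.re ≤ 0 := mul_nonpos_of_nonneg_of_nonpos hb hy0.le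
            _ < 1 / 8 := by norm_num
      linarith

/-- A star-convex set containing its centre is simply connected (contractible). [folklore] -/
theorem isSimplyConnected_of_starConvex {s : Set ℂ} {x : ℂ} (h : StarConvex ℝ x s) (hx : x ∈ s) :
    IsSimplyConnected s := by
  have : ContractibleSpace s := h.contractibleSpace ⟨x, hx⟩
  change SimplyConnectedSpace s
  infer_instance

/-- The unit disc is an admissible domain. [folklore] -/
theorem isAdmissibleDomain_ball : IsAdmissibleDomain (Metric.ball (0 : ℂ) 1) :=
  ⟨Metric.isOpen_ball, Metric.isBounded_ball, ⟨0, Metric.mem_ball_self one_pos⟩,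
    isSimplyConnected_of_starConvex ((convex_ball (0 : ℂ) 1).starConvex
      (Metric.mem_ball_self one_pos)) (Metric.mem_ball_self one_pos)⟩

/-- The slit disc is an admissible domain (open, bounded, nonempty, simply connected).
[folklore] -/
theorem isAdmissibleDomain_domain : IsAdmissibleDomain domain :=
  ⟨isOpen_domain, Metric.isBounded_ball.subset Set.sdiff_subset, ⟨0, zero_mem_domain⟩,
    isSimplyConnected_of_starConvex starConvex_domain zero_mem_domain⟩

/-- The slit has empty interior. [folklore] -/
theorem interior_slit : interior slit = ∅ := by
  refine Set.eq_empty_iff_forall_notMem.2 fun z hz => ?_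
  rcases Metric.mem_nhds_iff.1 (mem_interior_iff_mem_nhds.1 hz) with ⟨ε, hε, hball⟩
  have hz' : z ∈ slit := interior_subset hz
  have hzε : z + (ε / 2 : ℝ) * Complex.I ∈ slit := hball (by
    rw [Metric.mem_ball, dist_eq_norm, add_sub_cancel_left, norm_mul, Complex.norm_I, mul_one,
      Complex.norm_real, Real.norm_eq_abs, abs_of_pos (by positivity)]
    linarith)
  obtain ⟨h1, -⟩ := hz'
  obtain ⟨h2, -⟩ := hzε
  simp only [Complex.add_re, Complex.add_im, Complex.mul_re, Complex.mul_im, Complex.ofReal_re,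
    Complex.ofReal_im, Complex.I_re, Complex.I_im, mul_zero, sub_zero, add_zero,
    mul_one] at h2
  linarith

/-- The slit disc and the disc have the same closure. [folklore] -/
theorem closure_domain : closure domain = closure (Metric.ball (0 : ℂ) 1) := by
  refine Set.Subset.antisymm (closure_mono Set.sdiff_subset) (closure_minimal ?_ isClosed_closure)
  have hd : Dense slitᶜ := interior_eq_empty_iff_dense_compl.1 interior_slit
  simpa [domain, Set.sdiff_eq] using hd.open_subset_closure_inter Metric.isOpen_ball

/-- No mesh point of any lattice `δℤ²` lies on the slit (`√3` is irrational). [folklore] -/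
theorem meshPoint_not_mem_slit (δ : ℝ) (x : Site 2) : meshPoint δ x ∉ slit := by
  rintro ⟨h1, h2⟩
  simp only [meshPoint_re, meshPoint_im] at h1 h2
  have hδ : δ ≠ 0 := by rintro rfl; norm_num at h2
  have hx0 : ((x 0 : ℤ) : ℝ) ≠ 0 := by
    intro h; rw [h, mul_zero] at h2; norm_num at h2
  have h3 : Real.sqrt 3 = (x 1 : ℝ) / (x 0 : ℝ) := by
    rw [eq_div_iff hx0]
    have := mul_left_cancel₀ hδ (h1.trans (by ring : Real.sqrt 3 * (δ * (x 0 : ℝ)) = δ * (Real.sqrt 3 * x 0)))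
    linarith
  have hirr : Irrational (Real.sqrt 3) := by simpa using Nat.Prime.irrational_sqrt Nat.prime_three
  exact hirr.ne_rational (x 1) (x 0) (by exact_mod_cast h3)

/-- The slit disc and the disc have the same mesh vertices at every scale. [folklore] -/
theorem meshVertices_domain (δ : ℝ) : meshVertices domain δ = meshVertices (Metric.ball 0 1) δ := by
  ext x
  simp only [mem_meshVertices_iff, domain, Set.mem_sdiff]
  exact ⟨fun h => h.1, fun h => ⟨h, meshPoint_not_mem_slit δ x⟩⟩

/-- Hence the CHI limits of the slit disc and of the disc coincide. [folklore] -/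
theorem chiPlusCorr_domain (n : ℕ) (a : Fin n → ℂ) :
    chiPlusCorr domain n a = chiPlusCorr (Metric.ball 0 1) n a :=
  chiPlusCorr_eq_of_closure_eq closure_domain
    ⟨fun _ => Metric.isBounded_ball, fun h => h.subset Set.sdiff_subset⟩
    (fun δ _ => meshVertices_domain δ) n a

/-! #### The inverse Cayley transform as a uniformising map of the disc -/

/-- The inverse Cayley transform `w ↦ i(1 + w)/(1 - w)` is a conformal bijection of the unit disc
onto `ℍ` (from the bundled `Literature.Probability.RandomPlanarGeometry.cayley`). Ahlfors (1979), Ch. 3 §3. [folklore] -/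
theorem isConformalBijection_cayleyInvFun :
    IsConformalBijection RandomPlanarGeometry.cayleyInvFun (Metric.ball (0 : ℂ) 1) UpperHalfPlane.upperHalfPlaneSet :=
  ⟨RandomPlanarGeometry.cayley.symm.differentiableOn_coe, RandomPlanarGeometry.cayley.symm.bijOn⟩

/-- `cayley⁻¹(0) = i`. [folklore] -/
theorem cayleyInvFun_zero : RandomPlanarGeometry.cayleyInvFun 0 = Complex.I := by
  simp [RandomPlanarGeometry.cayleyInvFun_apply]

/-- `(cayley⁻¹)'(0) = 2i`. [folklore] -/
theorem hasDerivAt_cayleyInvFun_zero : HasDerivAt RandomPlanarGeometry.cayleyInvFun (2 * Complex.I) 0 := by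
  have h1 : HasDerivAt (fun w : ℂ => Complex.I * (1 + w)) (Complex.I * 1) 0 :=
    ((hasDerivAt_id (0 : ℂ)).const_add 1).const_mul Complex.I
  have h2 : HasDerivAt (fun w : ℂ => 1 - w) (-1) 0 := (hasDerivAt_id (0 : ℂ)).const_sub 1
  have h3 : HasDerivAt (fun w : ℂ => Complex.I * (1 + w) / (1 - w))
      ((Complex.I * 1 * ((fun w : ℂ => 1 - w) 0) -
        (fun w : ℂ => Complex.I * (1 + w)) 0 * (-1)) / ((fun w : ℂ => 1 - w) 0) ^ 2) 0 :=
    h1.div h2 (by norm_num)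
  have h4 : HasDerivAt RandomPlanarGeometry.cayleyInvFun ((Complex.I * 1 * ((fun w : ℂ => 1 - w) 0) -
        (fun w : ℂ => Complex.I * (1 + w)) 0 * (-1)) / ((fun w : ℂ => 1 - w) 0) ^ 2) 0 := h3
  refine h4.congr_deriv ?_
  simp only [mul_one, add_zero, sub_zero, mul_neg, sub_neg_eq_add, one_pow, div_one]
  ring

/-- `(cayley⁻¹)'(0) = 2i`, `deriv` form. [folklore] -/
theorem deriv_cayleyInvFun_zero : deriv RandomPlanarGeometry.cayleyInvFun 0 = 2 * Complex.I :=
  hasDerivAt_cayleyInvFun_zero.deriv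

/-! #### The square-root map -/

open Complex in
/-- `(p^{1/2})² = p`. [folklore] -/
theorem cpow_two_inv_sq (p : ℂ) : (p ^ (2⁻¹ : ℂ)) ^ 2 = p := by
  have h := Complex.cpow_nat_inv_pow p (n := 2) two_ne_zero
  rwa [Nat.cast_ofNat] at h

open Complex in
/-- The principal square root of a point off the closed negative axis has positive real part.
[folklore] -/
theorem cpow_two_inv_re_pos {p : ℂ} (hp : p ∈ slitPlane) : 0 < (p ^ (2⁻¹ : ℂ)).re := by
  rw [Complex.cpow_inv_two_re]
  apply Real.sqrt_pos.2
  have : 0 < ‖p‖ + p.re := by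
    rcases mem_slitPlane_iff.1 hp with h | h
    · linarith [norm_nonneg p]
    · have := (abs_lt.1 (abs_re_lt_norm.2 h)).1; linarith
  linarith

open Complex in
/-- For `w ∈ ℍ` off the vertical slit `(0, 3i/5]`, `-(w² + 9/25)` is off the closed negative
axis. [folklore] -/
theorem neg_sq_add_mem_slitPlane {w : ℂ} (hw : 0 < w.im) (hs : ¬ (w.re = 0 ∧ w.im ≤ 3 / 5)) :
    -(w ^ 2 + ((9 / 25 : ℝ) : ℂ)) ∈ slitPlane := by
  rw [mem_slitPlane_iff]
  have hre : (-(w ^ 2 + ((9 / 25 : ℝ) : ℂ))).re = w.im ^ 2 - w.re ^ 2 - 9 / 25 := by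
    rw [Complex.neg_re, Complex.add_re, Complex.ofReal_re, sq, Complex.mul_re]; ring
  have him : (-(w ^ 2 + ((9 / 25 : ℝ) : ℂ))).im = -(2 * w.re * w.im) := by
    rw [Complex.neg_im, Complex.add_im, Complex.ofReal_im, sq, Complex.mul_im]; ring
  rw [hre, him]
  by_cases h0 : w.re = 0
  · left
    have h35 : 3 / 5 < w.im := lt_of_not_ge fun h => hs ⟨h0, h⟩
    rw [h0]; nlinarith
  · right
    exact neg_ne_zero.2 (mul_ne_zero (mul_ne_zero two_ne_zero h0) hw.ne')

open Complex in
/-- `sqrtMap` maps `ℍ` minus the vertical slit `(0, 3i/5]` into `ℍ`. [folklore] -/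
theorem sqrtMap_im_pos {w : ℂ} (hw : 0 < w.im) (hs : ¬ (w.re = 0 ∧ w.im ≤ 3 / 5)) :
    0 < (sqrtMap w).im := by
  simp only [sqrtMap, Complex.mul_im, Complex.I_re, Complex.I_im, zero_mul, one_mul, zero_add]
  exact cpow_two_inv_re_pos (neg_sq_add_mem_slitPlane hw hs)

open Complex in
/-- `sqrtMap` is injective on `ℍ`. [folklore] -/
theorem sqrtMap_inj {w₁ w₂ : ℂ} (h₁ : 0 < w₁.im) (h₂ : 0 < w₂.im) (h : sqrtMap w₁ = sqrtMap w₂) :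
    w₁ = w₂ := by
  have h' : (-(w₁ ^ 2 + ((9 / 25 : ℝ) : ℂ))) ^ (2⁻¹ : ℂ) =
      (-(w₂ ^ 2 + ((9 / 25 : ℝ) : ℂ))) ^ (2⁻¹ : ℂ) :=
    mul_left_cancel₀ I_ne_zero h
  have h'' := congrArg (fun p : ℂ => p ^ 2) h'
  simp only [cpow_two_inv_sq, neg_inj, add_left_inj] at h''
  rcases sq_eq_sq_iff_eq_or_eq_neg.1 h'' with h3 | h3
  · exact h3
  · exfalso
    have := congrArg Complex.im h3
    simp at this; linarith

/-! #### The slit correspondence under rotation and the inverse Cayley transform -/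

open Complex in
/-- If the rotated-and-Cayley image of `z ∈ 𝔻` lies on the slit `(0, 3i/5]` of `ℍ`, then `z`
lies on the slit of the disc. [folklore] -/
theorem mem_slit_of_image {z : ℂ} (hz : ‖z‖ < 1)
    (h : (RandomPlanarGeometry.cayleyInvFun (-(starRingEnd ℂ dir) * z)).re = 0 ∧
      (RandomPlanarGeometry.cayleyInvFun (-(starRingEnd ℂ dir) * z)).im ≤ 3 / 5) : z ∈ slit := by
  set u : ℂ := -(starRingEnd ℂ dir) * z with hu
  set w : ℂ := RandomPlanarGeometry.cayleyInvFun u with hw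
  have hu1 : ‖u‖ < 1 := by
    rw [hu, norm_mul, norm_neg, Complex.norm_conj, norm_dir, one_mul]; exact hz
  have hune : u ≠ 1 := by rintro h1; rw [h1] at hu1; simp at hu1
  have hwim : 0 < w.im := RandomPlanarGeometry.cayleyInvFun_im_pos hu1
  have hcw : RandomPlanarGeometry.cayleyFun w = u := RandomPlanarGeometry.cayleyFun_cayleyInvFun hune
  obtain ⟨hre0, hle⟩ := h
  set y : ℝ := w.im with hy
  -- `w = i y` with `0 < y ≤ 3/5`
  have hwy : w = (y : ℂ) * I := by
    apply Complex.ext <;> simp [hre0, hy]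
  -- `u = (y - 1)/(y + 1)` is real
  have hureal : u = (((y - 1) / (y + 1) : ℝ) : ℂ) := by
    rw [← hcw, hwy, RandomPlanarGeometry.cayleyFun_apply]
    push_cast
    have hI : (y : ℂ) * I + I = ((y : ℂ) + 1) * I := by ring
    have hI' : (y : ℂ) * I - I = ((y : ℂ) - 1) * I := by ring
    rw [hI, hI', mul_div_mul_right _ _ I_ne_zero]
  -- hence `z = -dir * u = ((1 - y)/(1 + y)) · dir`
  have hz' : z = (((1 - y) / (1 + y) : ℝ) : ℂ) * dir := by
    have : z = -dir * u := by rw [hu]; linear_combination (-z) * conj_dir_mul_dir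
    rw [this, hureal]
    have hy1 : (y : ℂ) + 1 ≠ 0 := by
      intro h0; have := congrArg Complex.re h0; simp at this; linarith
    have hy1' : (1 : ℂ) + y ≠ 0 := by rwa [add_comm]
    push_cast
    field_simp
    ring
  rw [hz', ofReal_mul_dir_mem_slit_iff]
  rw [le_div_iff₀ (by linarith)]
  linarith [hle]

open Complex in
/-- Conversely, a point of the slit of the disc is sent onto the slit `(0, 3i/5]` of `ℍ`.
[folklore] -/
theorem image_of_mem_slit {z : ℂ} (hz : ‖z‖ < 1) (hs : z ∈ slit) :
    (RandomPlanarGeometry.cayleyInvFun (-(starRingEnd ℂ dir) * z)).re = 0 ∧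
      (RandomPlanarGeometry.cayleyInvFun (-(starRingEnd ℂ dir) * z)).im ≤ 3 / 5 := by
  set t : ℝ := 2 * z.re with ht
  have hzt : z = (t : ℂ) * dir := eq_mul_dir_of_mem_slit hs
  have ht4 : 1 / 4 ≤ t := (ofReal_mul_dir_mem_slit_iff t).1 (hzt ▸ hs)
  have ht1 : t < 1 := by
    have : ‖z‖ = t := by
      rw [hzt, norm_mul, norm_dir, mul_one, Complex.norm_real, Real.norm_eq_abs,
        abs_of_pos (by linarith)]
    linarith
  have hu : -(starRingEnd ℂ dir) * z = ((-t : ℝ) : ℂ) := by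
    rw [hzt]; push_cast; linear_combination (-(t : ℂ)) * conj_dir_mul_dir
  rw [hu, RandomPlanarGeometry.cayleyInvFun_apply]
  have h1t : (1 : ℂ) - ((-t : ℝ) : ℂ) = ((1 + t : ℝ) : ℂ) := by push_cast; ring
  have h1t' : (1 : ℂ) + ((-t : ℝ) : ℂ) = ((1 - t : ℝ) : ℂ) := by push_cast; ring
  have hne : (1 + t : ℝ) ≠ 0 := by linarith
  rw [h1t, h1t', mul_div_assoc, ← Complex.ofReal_div, Complex.mul_re, Complex.mul_im, Complex.I_re,
    Complex.I_im, Complex.ofReal_re, Complex.ofReal_im]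
  refine ⟨by ring, ?_⟩
  simp only [zero_mul, one_mul, zero_add]
  rw [div_le_iff₀ (by linarith)]
  linarith

/-! #### `unif` is a conformal bijection of the slit disc onto `ℍ` -/

open Complex in
/-- **The explicit uniformising map of the slit disc**: `unif` is a conformal bijection of
`SlitDisc.domain` onto `ℍ` (holomorphic, into `ℍ`, injective, surjective). [folklore] -/
theorem isConformalBijection_unif :
    IsConformalBijection unif domain UpperHalfPlane.upperHalfPlaneSet := by
  have hu1 : ∀ {z : ℂ}, ‖z‖ < 1 → ‖-(starRingEnd ℂ dir) * z‖ < 1 := fun hz => by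
    rw [norm_mul, norm_neg, Complex.norm_conj, norm_dir, one_mul]; exact hz
  have hne1 : ∀ {u : ℂ}, ‖u‖ < 1 → u ≠ 1 := fun hu h1 => by rw [h1] at hu; simp at hu
  refine ⟨?_, ?_, ?_, ?_⟩
  · -- holomorphy
    rintro z ⟨hz, hzs⟩
    rw [Metric.mem_ball, dist_zero_right] at hz
    have hw : 0 < (RandomPlanarGeometry.cayleyInvFun (-(starRingEnd ℂ dir) * z)).im := RandomPlanarGeometry.cayleyInvFun_im_pos (hu1 hz)
    have hns := fun h => hzs (mem_slit_of_image hz h)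
    apply DifferentiableAt.differentiableWithinAt
    have hA : DifferentiableAt ℂ (fun z : ℂ => -(starRingEnd ℂ dir) * z) z :=
      (differentiableAt_id.const_mul _)
    have hB : DifferentiableAt ℂ RandomPlanarGeometry.cayleyInvFun (-(starRingEnd ℂ dir) * z) :=
      RandomPlanarGeometry.differentiableOn_cayleyInvFun.differentiableAt (isOpen_ne.mem_nhds (hne1 (hu1 hz)))
    have hC : DifferentiableAt ℂ sqrtMap (RandomPlanarGeometry.cayleyInvFun (-(starRingEnd ℂ dir) * z)) := by
      have hq : DifferentiableAt ℂ (fun w : ℂ => -(w ^ 2 + ((9 / 25 : ℝ) : ℂ)))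
          (RandomPlanarGeometry.cayleyInvFun (-(starRingEnd ℂ dir) * z)) := by fun_prop
      unfold sqrtMap
      exact (hq.cpow_const (neg_sq_add_mem_slitPlane hw hns)).const_mul _
    exact hC.comp z (hB.comp z hA)
  · -- maps into `ℍ`
    rintro z ⟨hz, hzs⟩
    rw [Metric.mem_ball, dist_zero_right] at hz
    exact sqrtMap_im_pos (RandomPlanarGeometry.cayleyInvFun_im_pos (hu1 hz)) fun h => hzs (mem_slit_of_image hz h)
  · -- injective
    rintro z₁ ⟨hz₁, -⟩ z₂ ⟨hz₂, -⟩ h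
    rw [Metric.mem_ball, dist_zero_right] at hz₁ hz₂
    have h' := sqrtMap_inj (RandomPlanarGeometry.cayleyInvFun_im_pos (hu1 hz₁)) (RandomPlanarGeometry.cayleyInvFun_im_pos (hu1 hz₂)) h
    have h'' := congrArg RandomPlanarGeometry.cayleyFun h'
    rw [RandomPlanarGeometry.cayleyFun_cayleyInvFun (hne1 (hu1 hz₁)), RandomPlanarGeometry.cayleyFun_cayleyInvFun (hne1 (hu1 hz₂))] at h''
    have h''' := congrArg (fun u => -dir * u) h''
    simpa only [← mul_assoc, mul_neg, neg_mul, neg_neg, mul_comm dir, conj_dir_mul_dir,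
      one_mul] using h'''
  · -- surjective
    intro η hη
    have hη' : 0 < η.im := hη
    set s : ℂ := -I * η with hs
    have hsre : s.re = η.im := by simp [hs]
    have hsre_pos : 0 < s.re := hsre ▸ hη'
    set m : ℂ := -s ^ 2 - ((9 / 25 : ℝ) : ℂ) with hm
    -- if `m` (or anything forcing `s²` real) is real then `s` is real
    have hsim_of : (s ^ 2).im = 0 → s.im = 0 := fun h => by
      have : (s ^ 2).im = 2 * s.re * s.im := by simp [sq]; ring
      rw [this] at h
      rcases mul_eq_zero.1 h with h | h
      · exact absurd h (mul_ne_zero two_ne_zero hsre_pos.ne')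
      · exact h
    have hs2re : s.im = 0 → (s ^ 2).re = s.re ^ 2 := fun h => by
      rw [sq, Complex.mul_re, h, mul_zero, sub_zero, sq]
    have hm_im : m.im = -(s ^ 2).im := by rw [hm]; simp
    have hm_re : m.re = -(s ^ 2).re - 9 / 25 := by rw [hm]; simp
    set p : ℂ := m ^ (2⁻¹ : ℂ) with hp
    have hp2 : p ^ 2 = m := cpow_two_inv_sq m
    have hpim : p.im ≠ 0 := by
      intro h0
      have hmim : m.im = 0 := by
        rw [← hp2, sq, Complex.mul_im, h0, mul_zero, zero_mul, add_zero]
      have hmre : 0 ≤ m.re := by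
        rw [← hp2, sq, Complex.mul_re, h0, mul_zero, sub_zero]; exact mul_self_nonneg _
      have hs2im : (s ^ 2).im = 0 := by linarith
      have h4 := hs2re (hsim_of hs2im)
      rw [hm_re, h4] at hmre
      nlinarith [sq_nonneg s.re]
    -- the square root of `m` in the upper half-plane
    set w : ℂ := if 0 < p.im then p else -p with hw
    have hwim : 0 < w.im := by
      rw [hw]; split_ifs with h
      · exact h
      · simp; exact lt_of_le_of_ne (not_lt.1 h) hpim
    have hw2 : w ^ 2 = m := by rw [hw]; split_ifs <;> simp [hp2]
    have hws : ¬ (w.re = 0 ∧ w.im ≤ 3 / 5) := by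
      rintro ⟨hwre, hwle⟩
      have hmim : m.im = 0 := by
        rw [← hw2, sq, Complex.mul_im, hwre, mul_zero, zero_mul, add_zero]
      have hmre : m.re = -(w.im * w.im) := by
        rw [← hw2, sq, Complex.mul_re, hwre, mul_zero, zero_sub]
      have hs2im : (s ^ 2).im = 0 := by linarith
      have h4 := hs2re (hsim_of hs2im)
      rw [hm_re, h4, hsre] at hmre
      nlinarith [hwle, hwim, hη']
    -- pull back through the Cayley transform and the rotation
    have hwI : w + I ≠ 0 := RandomPlanarGeometry.add_I_ne_zero hwim.le
    set u : ℂ := RandomPlanarGeometry.cayleyFun w with hu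
    have hu1' : ‖u‖ < 1 := (RandomPlanarGeometry.norm_cayleyFun_lt_one_iff hwI).2 hwim
    set z : ℂ := -dir * u with hz
    have hzu : -(starRingEnd ℂ dir) * z = u := by
      rw [hz, ← mul_assoc, neg_mul, mul_neg, neg_neg, conj_dir_mul_dir, one_mul]
    have hz1 : ‖z‖ < 1 := by rw [hz, norm_mul, norm_neg, norm_dir, one_mul]; exact hu1'
    have hwz : RandomPlanarGeometry.cayleyInvFun (-(starRingEnd ℂ dir) * z) = w := by
      rw [hzu, hu, RandomPlanarGeometry.cayleyInvFun_cayleyFun hwI]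
    refine ⟨z, ⟨by rwa [Metric.mem_ball, dist_zero_right], fun hzs => hws ?_⟩, ?_⟩
    · have := image_of_mem_slit hz1 hzs
      rwa [hwz] at this
    · rw [unif, hwz, sqrtMap, hw2, hm]
      have : -(-s ^ 2 - ((9 / 25 : ℝ) : ℂ) + ((9 / 25 : ℝ) : ℂ)) = s ^ 2 := by ring
      rw [this, Complex.sq_cpow_two_inv hsre_pos, hs, ← mul_assoc, mul_neg, I_mul_I, neg_neg,
        one_mul]

/-! #### Values at the centre -/

open Complex in
/-- `(16/25)^{1/2} = 4/5` (principal branch). [folklore] -/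
theorem cpow_sixteen_div :  ((16 / 25 : ℂ)) ^ (2⁻¹ : ℂ) = 4 / 5 := by
  have h : (16 / 25 : ℂ) = (4 / 5) ^ 2 := by norm_num
  rw [h]
  exact Complex.sq_cpow_two_inv (by norm_num)

open Complex in
/-- `-(i² + 9/25) = 16/25`. [folklore] -/
theorem neg_I_sq_add : -(I ^ 2 + ((9 / 25 : ℝ) : ℂ)) = 16 / 25 := by
  rw [I_sq]; push_cast; norm_num

open Complex in
/-- `sqrtMap i = 4i/5`. [folklore] -/
theorem sqrtMap_I : sqrtMap I = (4 / 5 : ℂ) * I := by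
  rw [sqrtMap, neg_I_sq_add, cpow_sixteen_div, mul_comm]

open Complex in
/-- `unif 0 = 4i/5`. [folklore] -/
theorem unif_zero : unif 0 = (4 / 5 : ℂ) * I := by
  rw [unif, mul_zero, cayleyInvFun_zero, sqrtMap_I]

open Complex in
/-- `Im unif 0 = 4/5`. [folklore] -/
theorem unif_zero_im : (unif 0).im = 4 / 5 := by
  rw [unif_zero]; simp

open Complex in
/-- `sqrtMap'(i) = 5/4`. [folklore] -/
theorem hasDerivAt_sqrtMap_I : HasDerivAt sqrtMap (5 / 4) I := by
  have hq0 : HasDerivAt (fun w : ℂ => -(w ^ 2 + ((9 / 25 : ℝ) : ℂ))) (-(↑(2 : ℕ) * I ^ (2 - 1))) I :=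
    ((hasDerivAt_pow 2 I).add_const ((9 / 25 : ℝ) : ℂ)).neg
  have hq : HasDerivAt (fun w : ℂ => -(w ^ 2 + ((9 / 25 : ℝ) : ℂ))) (-(2 * I)) I :=
    hq0.congr_deriv (by simp)
  have hsp : -(I ^ 2 + ((9 / 25 : ℝ) : ℂ)) ∈ slitPlane := by
    rw [neg_I_sq_add]
    have : (16 / 25 : ℂ) = ((16 / 25 : ℝ) : ℂ) := by norm_num
    rw [this]; exact ofReal_mem_slitPlane.2 (by norm_num)
  have h : HasDerivAt (fun w : ℂ => I * (-(w ^ 2 + ((9 / 25 : ℝ) : ℂ))) ^ (2⁻¹ : ℂ))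
      (I * ((2⁻¹ : ℂ) * (-(I ^ 2 + ((9 / 25 : ℝ) : ℂ))) ^ ((2⁻¹ : ℂ) - 1) * (-(2 * I)))) I :=
    (hq.cpow_const hsp).const_mul I
  have hfun : (fun w : ℂ => I * (-(w ^ 2 + ((9 / 25 : ℝ) : ℂ))) ^ (2⁻¹ : ℂ)) = sqrtMap := rfl
  rw [hfun] at h
  convert h using 1
  rw [neg_I_sq_add]
  have h1 : (2⁻¹ : ℂ) - 1 = -(2⁻¹ : ℂ) := by norm_num
  rw [h1, Complex.cpow_neg, cpow_sixteen_div]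
  linear_combination (5 / 4 : ℂ) * I_sq

open Complex in
/-- `unif'(0) = (5/4) · 2i · (-conj dir)` (chain rule). [folklore] -/
theorem hasDerivAt_unif_zero :
    HasDerivAt unif (5 / 4 * (2 * I * -(starRingEnd ℂ dir))) 0 := by
  have hA : HasDerivAt (fun z : ℂ => -(starRingEnd ℂ dir) * z) (-(starRingEnd ℂ dir)) 0 := by
    simpa using (hasDerivAt_id (0 : ℂ)).const_mul (-(starRingEnd ℂ dir))
  have hB : HasDerivAt (RandomPlanarGeometry.cayleyInvFun ∘ fun z : ℂ => -(starRingEnd ℂ dir) * z)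
      (2 * I * -(starRingEnd ℂ dir)) 0 :=
    hasDerivAt_cayleyInvFun_zero.comp_of_eq 0 hA (by simp)
  have hC : HasDerivAt (sqrtMap ∘ (RandomPlanarGeometry.cayleyInvFun ∘ fun z : ℂ => -(starRingEnd ℂ dir) * z))
      (5 / 4 * (2 * I * -(starRingEnd ℂ dir))) 0 :=
    hasDerivAt_sqrtMap_I.comp_of_eq 0 hB (by simp [Function.comp, cayleyInvFun_zero])
  exact hC

open Complex in
/-- `|unif'(0)| = 5/2`. [folklore] -/
theorem norm_deriv_unif_zero : ‖deriv unif 0‖ = 5 / 2 := by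
  rw [hasDerivAt_unif_zero.deriv, norm_mul, norm_mul, norm_mul, norm_neg, Complex.norm_conj,
    norm_dir, Complex.norm_I]
  norm_num

end SlitDisc

-- `chi_halfplane_onePoint` is an `@[deprecated]` record (refuted here; verdict clean-up 2026-08-15) and its
-- refutation must name it; REMOVE-WHEN the deprecated def is deleted from `PlanarIsing.lean`.
set_option linter.deprecated false in
/-- **`chi_halfplane_onePoint` is false as stated.** The slit disc `SlitDisc.domain` and the
disc are both admissible, have the same closure and the same mesh vertices at every scale, hence
literally the same CHI limit `chiPlusCorr · 1 ![0]`; but the right-hand side of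
`chi_halfplane_onePoint` at `a = 0` is `𝒞` for the disc (inverse Cayley transform: `φ(0) = i`,
`|φ'(0)| = 2`) and `𝒞 · (25/16)^{1/8}` for the slit disc (`SlitDisc.unif`: `Im φ(0) = 4/5`,
`|φ'(0)| = 5/2`). The missing hypothesis is CHI's approximation assumption, restored in
`chi_halfplane_onePoint_hausdorff`. [folklore] -/
theorem not_chi_halfplane_onePoint : ¬ chi_halfplane_onePoint := by
  rintro ⟨C, hC, H⟩
  have h1 := H (Metric.ball 0 1) RandomPlanarGeometry.cayleyInvFun SlitDisc.isAdmissibleDomain_ball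
    SlitDisc.isConformalBijection_cayleyInvFun 0 (Metric.mem_ball_self one_pos)
  have h2 := H SlitDisc.domain SlitDisc.unif SlitDisc.isAdmissibleDomain_domain
    SlitDisc.isConformalBijection_unif 0 SlitDisc.zero_mem_domain
  have e1 : ‖deriv RandomPlanarGeometry.cayleyInvFun 0‖ = 2 := by
    rw [SlitDisc.deriv_cayleyInvFun_zero, norm_mul, Complex.norm_I, mul_one]; simp
  have e2 : (RandomPlanarGeometry.cayleyInvFun 0).im = 1 := by rw [SlitDisc.cayleyInvFun_zero, Complex.I_im]
  rw [e1, e2, show (2 : ℝ) * 1 = 2 by norm_num] at h1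
  rw [SlitDisc.chiPlusCorr_domain, h1, SlitDisc.norm_deriv_unif_zero, SlitDisc.unif_zero_im,
    show (2 : ℝ) * (4 / 5) = 8 / 5 by norm_num] at h2
  -- h2 : C * 2 ^ (1/8) * 2 ^ (-1/8) = C * (5/2) ^ (1/8) * (8/5) ^ (-1/8)
  have key : (2 : ℝ) ^ ((1 : ℝ) / 8) * (2 : ℝ) ^ (-(1 : ℝ) / 8) = 1 := by
    rw [← Real.rpow_add two_pos]; norm_num
  have key' : (5 / 2 : ℝ) ^ ((1 : ℝ) / 8) * (8 / 5 : ℝ) ^ (-(1 : ℝ) / 8) =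
      (25 / 16 : ℝ) ^ ((1 : ℝ) / 8) := by
    rw [show (-(1 : ℝ) / 8) = -((1 : ℝ) / 8) by ring, Real.rpow_neg (by norm_num),
      ← Real.inv_rpow (by norm_num), ← Real.mul_rpow (by norm_num) (by norm_num)]
    norm_num
  have hgt : (1 : ℝ) < (25 / 16 : ℝ) ^ ((1 : ℝ) / 8) :=
    Real.one_lt_rpow (by norm_num) (by norm_num)
  rw [mul_assoc, key, mul_one, mul_assoc, key'] at h2
  have hx : (1 : ℝ) = (25 / 16 : ℝ) ^ ((1 : ℝ) / 8) := mul_left_cancel₀ hC.ne' ((mul_one C).trans h2)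
  exact absurd hx hgt.ne

end Literature.Probability.LatticeModels
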